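import Summits.HodgeConjecture.HodgeConjecture.Theorems.R90S5HsphOfFlathAdmissible           -- ★ (this seat) road γ heads incl. `…_of_baseChange`, `…_qs_of_le_cuspidalSubspace`; brings `xiFamilyOfRecord`, `clFinChoice`, `evpAtIntegralLevel`
import Summits.HodgeConjecture.HodgeConjecture.Theorems.R90S10GermOfDiscreteClass           -- ★ S10 (R90-C138-typ2): `R90.S10.germOfDiscreteClass S c` (FILE F's `germRep` body) + read-back `germOfDiscreteClass_mk`
import HarnessLib

/-!
# R90-TF · S5 «Ch. 13.3» — ROAD γ IN S10's GERM CURRENCY (offer O1): `t(mk P) = t(⊗_v πⁿ(ξ_v))` for a ξ-ENVELOPE MEMBER, read on ★ `R90.S10.germOfDiscreteClass`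
# (`Theorems/R90S5GermOfEnvelopeMember.lean`; seat R90-C133-p03 (g0); R90-C133-plan (g0) DEAL #4 «O1 germ-pin adapter = yours the moment S10 fixes names» — S10 fixed
# `germRep := germOfDiscreteClass S` (R90-C138-typ2, `Theorems/R90S10GermOfDiscreteClass.lean`, junction J3-R3 ∕ pin (P3)))

Cell `hodgecm-mathlib`, crux H413 (`stmt-HodgeConjecture-24833`), route of record `HCCMUnconditional`; programme R90-TF, section S5 (base `R90-C133`).  PROOF lane
(`--supports stmt-HodgeConjecture-24833 --as helper`): theorems only; Lines-free.  THE PIN (P3) of S5's pay editions (`QsPinnedXiDatumAt` (P3), `QsPinnedXiStringDatum` (P3-evp),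
p03's CENSUS π1∕π2) reads «`𝔨.germRep (cls P) = 𝔨.germI ξH`» with, at S10's honest datum (FILE F), `cls P := DiscreteClass.mk P` and `germRep := R90.S10.germOfDiscreteClass S`.
This file delivers the `P`-side half of that equation in S10's currency: for `P` in the ξ-envelope, `germOfDiscreteClass S (mk P)` IS the E1 package of the record ξ-string
`v ↦ πⁿ(ξ_v)` off every `S ⊇ S₀(P, ξ)` — so the pin closes by `rfl`∕`rw` once S10 sets `germI ξH := evpAtIntegralLevel … (v ↦ (xiFamilyOfRecord ξ v).πn) S _` (or by ★
`evpOfClass_congr` against any other spherical representative of `t(I_{ξ̃′})` S10 chooses).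

CONTENTS (sorry-free): `germOfDiscreteClass_mk_eq_record_of_memXiFamily` (V6-free: binders `μω hμu hμω P ξ`, `MemXiFamily`, `hsph`), `…_of_automorphicFlathAdmissible` («AFA»),
`…_qs_of_le_cuspidalSubspace` (U(Φ₃), cuspidal `P`, hypothesis-free), each: `∃ S₀, ∀ S ⊇ ↑S₀, ∃ hξ, germOfDiscreteClass S (DiscreteClass.mk P) = evpAtIntegralLevel L 3 H (record ξ) S hξ`.
[cite: Rogawski1990, §13.6 pp. 209–210; §13.3 p. 201, Thm. 13.3.5 p. 202; Prop. 13.2.2 (d) p. 201; §14.5 p. 237] [cite: FlathCorvallis1979, Thm. 3] [cite: CartierCorvallis1979, §IV.1 Cor. 4.1]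
HONEST LABEL: helper (the `P`-side of pin (P3)); closes no socket; REL ≠ ★ ≠ BUILT; HC_CM is proved only modulo the 7 printed citations (2 remaining named inputs:
hLiu418 = stmt-HodgeConjecture-24832, h413 = stmt-HodgeConjecture-24833) until rung 0 closes.
-/

set_option autoImplicit false
-- the mandated namespace repeats the single-problem summit's segment (`HodgeConjecture.HodgeConjecture`)
set_option linter.dupNamespace false

noncomputable section

open NumberField IsDedekindDomain MeasureTheory Filter
open scoped Matrix
open Literature.NumberTheory.Rogawski1990 Literature.NumberTheory.GaloisRepresentations
open Literature.NumberTheory.Automorphic Literature.NumberTheory.Automorphic.UnitaryGroup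

namespace Summit.HodgeConjecture.HodgeConjecture.R90.S5

open Summit.HodgeConjecture.HodgeConjecture.Cruxes.H413
open Summit.HodgeConjecture.HodgeConjecture.Cruxes.H413.F0P3InnerFormClassificationV6
open Summit.HodgeConjecture.HodgeConjecture.Cruxes.H413.F0P3ClassTokenChoice (clFinChoice admUnitConstituents)
open Summit.HodgeConjecture.HodgeConjecture.Cruxes.H413.F0P3XiLocalFamilyOfRecord (xiFamilyOfRecord)
open Summit.HodgeConjecture.HodgeConjecture.Cruxes.H413.K2E1EvpOfAutomorphicClass (evpAtIntegralLevel)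
open Summit.HodgeConjecture.HodgeConjecture.Cruxes.H413.K2E1SpectralTermsDiscreteHalf (DiscreteClass)
open Summit.HodgeConjecture.HodgeConjecture.R90.S10 (germOfDiscreteClass germOfDiscreteClass_mk)

variable (L : Type) [Field L] [NumberField L] [IsCMField L] (H : Matrix (Fin 3) (Fin 3) L)
  (hH : (H.map (cmConjRingHom L))ᵀ = H) (hHd : IsUnit H.det) (μω : HeckeCharacter L) (hμu : μω.IsUnitary)
  (μ : Measure (Gp L H).automorphicQuotient) [(Gp L H).IsAutomorphicMeasure μ]

/-- **PIN (P3), `P`-SIDE, IN S10's CURRENCY: `t(mk P) = t(⊗_v πⁿ(ξ_v))`.**  For a discrete `P` of `U(H)` in the ξ-envelope (★ `MemXiFamily`; `μ|𝕀_{L⁺} = ω_{L/L⁺}`) with the cofinite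
spherical supply `hsph`, there is a finite `S₀(P, ξ)` such that for every level `S ⊇ S₀` the S10 germ of the discrete class of `P` (★ `R90.S10.germOfDiscreteClass S (DiscreteClass.mk P)`,
FILE F's `germRep`) EQUALS the E1 eigenvalue package of the record ξ-string `v ↦ (xiFamilyOfRecord ξ v).πn` (spherical off `S`, witness `hξ`).  ★ `xiString_exists_finset_evpAtIntegralLevel_eq_of_baseChange`
(γ-evp, V6-free) + ★ `germOfDiscreteClass_mk` (representative-independence read-back). [cite: Rogawski1990, §13.6 pp. 209–210; Thm. 13.3.5 p. 202; §14.5 p. 237] -/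
theorem germOfDiscreteClass_mk_eq_record_of_memXiFamily
    (hμω : ∀ x : Literature.NumberTheory.GaloisRepresentations.ideleGroup ↥(maximalRealSubfield L),
      μω (AdeleRing.ideleBaseChange (↥(maximalRealSubfield L)) L x) = quadraticHeckeCharCM L x)
    (P : DiscreteAutomorphicRep (Gp L H) μ) (ξ : OneDimAutRepH L) (hmem : MemXiFamily P hH hHd μω hμu ξ)
    (hsph : ∀ᶠ v : HeightOneSpectrum (𝓞 ↥(maximalRealSubfield L)) in cofinite,
      ∃ c ∈ admUnitConstituents P v, c.IsSpherical (cmLocalIntegralLevel L 3 H v)) :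
    ∃ S₀ : Finset (HeightOneSpectrum (𝓞 ↥(maximalRealSubfield L))),
      ∀ (S : Set (HeightOneSpectrum (𝓞 ↥(maximalRealSubfield L)))), (↑S₀ : Set _) ⊆ S →
        ∃ hξ : ∀ v, v ∉ S → (xiFamilyOfRecord L H hH hHd μω hμu ξ v).πn.IsSpherical (cmLocalIntegralLevel L 3 H v),
          germOfDiscreteClass S (DiscreteClass.mk P) =
            evpAtIntegralLevel L 3 H (fun v => (xiFamilyOfRecord L H hH hHd μω hμu ξ v).πn) S hξ := by
  obtain ⟨S₀, hS₀, hevp⟩ := xiString_exists_finset_evpAtIntegralLevel_eq_of_baseChange L H hH hHd μω hμu μ hμω P ξ hmem hsph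
  refine ⟨S₀, fun S hS => ?_⟩
  have hP : ∀ v, v ∉ S → (clFinChoice P v).IsSpherical (cmLocalIntegralLevel L 3 H v) := fun v hv => (hS₀ v fun h => hv (hS h)).1
  have hξ : ∀ v, v ∉ S → (xiFamilyOfRecord L H hH hHd μω hμu ξ v).πn.IsSpherical (cmLocalIntegralLevel L 3 H v) :=
    fun v hv => (hS₀ v fun h => hv (hS h)).2.1
  exact ⟨hξ, (germOfDiscreteClass_mk S P hP).trans (hevp S hS hP hξ)⟩

/-- **The same UNDER «AFA»** (★ NF `AutomorphicFlathAdmissible`: every discrete `P` has an irreducible admissible finite component ⇒ `hsph`, ★ `hsph_of_automorphicFlathAdmissible`).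
[cite: Rogawski1990, §13.6 pp. 209–210; §14.5 p. 237] [cite: FlathCorvallis1979, Thm. 3] -/
theorem germOfDiscreteClass_mk_eq_record_of_automorphicFlathAdmissible
    (hAF : AutomorphicFlathAdmissible (↥(maximalRealSubfield L)) L (IsCMField.complexConj L) 3 H μ)
    (hμω : ∀ x : Literature.NumberTheory.GaloisRepresentations.ideleGroup ↥(maximalRealSubfield L),
      μω (AdeleRing.ideleBaseChange (↥(maximalRealSubfield L)) L x) = quadraticHeckeCharCM L x)
    (P : DiscreteAutomorphicRep (Gp L H) μ) (ξ : OneDimAutRepH L) (hmem : MemXiFamily P hH hHd μω hμu ξ) :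
    ∃ S₀ : Finset (HeightOneSpectrum (𝓞 ↥(maximalRealSubfield L))),
      ∀ (S : Set (HeightOneSpectrum (𝓞 ↥(maximalRealSubfield L)))), (↑S₀ : Set _) ⊆ S →
        ∃ hξ : ∀ v, v ∉ S → (xiFamilyOfRecord L H hH hHd μω hμu ξ v).πn.IsSpherical (cmLocalIntegralLevel L 3 H v),
          germOfDiscreteClass S (DiscreteClass.mk P) =
            evpAtIntegralLevel L 3 H (fun v => (xiFamilyOfRecord L H hH hHd μω hμu ξ v).πn) S hξ :=
  germOfDiscreteClass_mk_eq_record_of_memXiFamily L H hH hHd μω hμu μ hμω P ξ hmem (hsph_of_automorphicFlathAdmissible L H μ hAF P)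

/-- **The same for a CUSPIDAL `P` of the quasi-split `U(Φ₃)` — HYPOTHESIS-FREE beyond (QS-U)'s own binders** (★ `hsph_qs_of_le_cuspidalSubspace`: GGPS ★ via K2E1-p12).
[cite: Rogawski1990, §13.6 pp. 209–210; Thm. 13.3.5 p. 202] [cite: GelfandGraevPiatetskiShapiro1969, Ch. 3] -/
theorem germOfDiscreteClass_mk_eq_record_qs_of_le_cuspidalSubspace
    (μq : Measure (Gp L (qsForm L)).automorphicQuotient) [(Gp L (qsForm L)).IsAutomorphicMeasure μq]
    (hH' : ((qsForm L).map (cmConjRingHom L))ᵀ = qsForm L) (hHd' : IsUnit (qsForm L).det)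
    (hμω : ∀ x : Literature.NumberTheory.GaloisRepresentations.ideleGroup ↥(maximalRealSubfield L),
      μω (AdeleRing.ideleBaseChange (↥(maximalRealSubfield L)) L x) = quadraticHeckeCharCM L x)
    (P : DiscreteAutomorphicRep (Gp L (qsForm L)) μq)
    (hP : P.space ≤ (adelicGroupData (↥(maximalRealSubfield L)) L (IsCMField.complexConj L) 3 (qsForm L)).cuspidalSubspace μq
      (K2E1CuspidalSpectrumUnitary.cmParabolicDataR L 3))
    (ξ : OneDimAutRepH L) (hmem : MemXiFamily P hH' hHd' μω hμu ξ) :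
    ∃ S₀ : Finset (HeightOneSpectrum (𝓞 ↥(maximalRealSubfield L))),
      ∀ (S : Set (HeightOneSpectrum (𝓞 ↥(maximalRealSubfield L)))), (↑S₀ : Set _) ⊆ S →
        ∃ hξ : ∀ v, v ∉ S → (xiFamilyOfRecord L (qsForm L) hH' hHd' μω hμu ξ v).πn.IsSpherical (cmLocalIntegralLevel L 3 (qsForm L) v),
          germOfDiscreteClass S (DiscreteClass.mk P) =
            evpAtIntegralLevel L 3 (qsForm L) (fun v => (xiFamilyOfRecord L (qsForm L) hH' hHd' μω hμu ξ v).πn) S hξ :=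
  germOfDiscreteClass_mk_eq_record_of_memXiFamily L (qsForm L) hH' hHd' μω hμu μq hμω P ξ hmem (hsph_qs_of_le_cuspidalSubspace L μq P hP)

end Summit.HodgeConjecture.HodgeConjecture.R90.S5

end
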